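import Summits.QuantumFields.YangMills.Theorems.BalabanUVNodesN12TowerForest
import HarnessLib

/-!
# BalabanUVNodes ∕ N12 — THE PRINTED COLLAR `dist(Ω_N, Ω_{N−1}ᶜ) ≥ L^N M₁` OF [III] (2.13) AT THE FINE LEVEL, the uniqueness of the `Γ`-level of a site, and WHERE THE ROOT POINTS OF A
# `Γ_J`-BLOCK OF `𝐁_k(Z)` CAN BE: the block's centre, or (`J ≥ 1`) the centre of a face-layer `(J−1)`-block (an end of a member `(J−1)`-bond) — levels `≤ J − 2` are excluded by the
# collar; whence a site of a face-layer `(J−1)`-block hangs, in any rooted forest with (ROOTBLK), from THAT block's centre (the `𝐁_k(Z)`-geometry half of dag-n12-w6's Q2-DESIGN §1∕§8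
# reading «roots = block CENTRES»)

Cell `pub-ymgap` (HUMAN RULINGS D-0062 ∕ D-0149), WIDTH SEAT `pub-ymgap-dag-n12-w3` g3 (node N12 = [B15]; key K1⁹ `stmt-QuantumFields-27364` (KEY MAP v2), `--kind proof --supports … --as
helper`; count-neutral).  THEOREMS ONLY (0 `def`, 0 `instance`, 0 `sorry`); consumed BY NAME: r11∕r12's `B14.Eq213DetSet.dist_maxDomT` ∕ `isBlockUnion_maxDomT(_succ)` ∕ `Bj_zero` ∕
`Bj_mid` ∕ `Bj_top` ∕ `Bj_of_gt` ∕ `maxDomT_antitone`, `B15Eq112TorusCover.cover` ∕ `lift` ∕ `cover_lift`, `B14DomainGeom.Within`, `B5Eq118OneStroke.val_iterBlockOf`,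
`Prop7FlatHolonomy.sitesPerDir_zero_eq_mul_pow`, this lineage's `N12FlatHndRecordLetters.blockIter_eq_iterBlockOf`, `N12FlatHndConnLetter.embIter_iterBlockOf_embIter`,
`BIJ88RT51Background.iterBlockOf_embIter`, n07's `N07CritMultiScaleLamBond.iterBlockOf_congr_of_le`.

CONTENTS.  §1 `exists_int_rep_of_blockIdx` (labels whose `i`-block indices agree or differ by one differ by an integer of size `≤ 2L^i − 1` mod the period), ★★
`mem_maxDomT_pred_of_blockIdx` (THE COLLAR AT THE FINE LEVEL: `M₁ ≥ 2`, `1 ≤ N ≤ k`, `i ≤ N`, `x ∈ Ω_N`, the `i`-block of `z` equal or adjacent (per coordinate) to that of `x` ⇒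
`z ∈ Ω_{N−1}`).  §2 `mem_maxDomT_iff_of_iterBlockOf_eq`, `le_of_iterBlockOf_mem_Bj`, `mem_maxDomT_of_iterBlockOf_mem_Bj`, `not_mem_maxDomT_of_iterBlockOf_mem_Bj`, ★
`eq_of_iterBlockOf_mem_Bj` (the `Γ`-level of a site is unique), `idx_adj_of_bond`, ★★★ `rootPoint_classification`, ★ `rootPoint_eq_centre_pred` (a root point inside a `Γ_J`-block,
`J ≥ 1`, is the centre of its own `(J−1)`-block), ★★ `root_eq_centre_pred_of_rooted` (a site whose `(J−1)`-block's centre is a root point hangs from that centre, given (ROOTBLK) at the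
levels `J − 1`, `J`).

HONEST FRAMING.  Lattice bookkeeping (label arithmetic, the printed collar read on the cover); no analysis; nothing of Bałaban's asserted; N12 NOT discharged; K1⁹ NOT closed; counts
unmoved (typed 28∕28 · discharged 5∕27); one finite 𝕋⁴ programme at fixed ε — R4 closes the conditional rung `BalabanLadder.UV` only; the Yang–Mills mass gap (Clay) is NOT proved by
any of this; nothing continuum ∕ ℝ⁴ ∕ OS.
-/

noncomputable section

namespace Summit.QuantumFields.YangMills.BalabanUVNodes.N12BjCollarRoots

open scoped BigOperators
open Literature.MathematicalPhysics.QuantumFieldTheory.Balaban1983to89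
open T4Continuum
open B15DeterminingSets
open B5Eq118OneStroke (iterBlockOf iterBlockOf_succ val_iterBlockOf)
open B14DomainGeom (Within)
open B15Eq112TorusCover (cover lift cover_lift cover_apply)
open B14.Eq213MaximalDomains (side)
open B14.Eq213DetSet (Bj Bj_zero Bj_mid Bj_top Bj_of_gt maxDomT maxDomT_antitone maxDomT_succ_subset dist_maxDomT isBlockUnion_maxDomT isBlockUnion_maxDomT_succ)
open B14.Eq22Determines (blockIter IsBlockUnion)
open Summit.QuantumFields.YangMills.Theorems.Prop7FlatHolonomy (sitesPerDir_zero_eq_mul_pow)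
open Summit.QuantumFields.YangMills.BalabanUVNodes.N12FlatHndRecordLetters (blockIter_eq_iterBlockOf)
open Literature.MathematicalPhysics.QuantumFieldTheory.BalabanImbrieJaffe1984to88.BIJ88RT51Background (iterBlockOf_embIter)
open Summit.QuantumFields.YangMills.BalabanUVNodes.N12FlatHndConnLetter (embIter_iterBlockOf_embIter)
open Summit.QuantumFields.YangMills.BalabanUVNodes.N07CritMultiScaleLamBond (iterBlockOf_congr_of_le)

variable {P : Params}

/-! ## §1 The printed collar at the fine level: a site whose block touches the block of a point of `Ω_N` lies in `Ω_{N−1}` -/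

section Collar

/-- **Label bookkeeping**: if in a coordinate the `i`-block indices of two fine sites agree or differ by one (as residues), the difference of their labels has an integer
representative of size `≤ 2L^i − 1`. [cite: Balaban1987RG1, (0.1)–(0.3) pp.251–252 (bookkeeping)] -/
theorem exists_int_rep_of_blockIdx {i : ℕ} (hi : i ≤ P.m + P.K) (x z : Site P 0) (ν : Fin P.d)
    (h : iterBlockOf i z ν = iterBlockOf i x ν ∨ iterBlockOf i z ν = iterBlockOf i x ν + 1 ∨ iterBlockOf i x ν = iterBlockOf i z ν + 1) :
    ∃ e : ℤ, |e| ≤ 2 * (P.L ^ i : ℕ) - 1 ∧ (e : ZMod (P.sitesPerDir 0)) = z ν - x ν := by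
  have hL : 0 < P.L ^ i := pow_pos P.L_pos i
  have hN : P.sitesPerDir 0 = P.sitesPerDir i * P.L ^ i := sitesPerDir_zero_eq_mul_pow hi
  -- the one-sided statement: index of `z` = index of `x` plus one
  have main : ∀ x z : Site P 0, iterBlockOf i z ν = iterBlockOf i x ν + 1 →
      ∃ e : ℤ, |e| ≤ 2 * (P.L ^ i : ℕ) - 1 ∧ (e : ZMod (P.sitesPerDir 0)) = z ν - x ν := by
    intro x z hzx
    obtain ⟨a, ha⟩ : ∃ a : ℕ, (z ν).val = a := ⟨_, rfl⟩
    obtain ⟨b, hb⟩ : ∃ b : ℕ, (x ν).val = b := ⟨_, rfl⟩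
    have hza : (z ν : ZMod (P.sitesPerDir 0)) = (a : ZMod (P.sitesPerDir 0)) := by rw [← ha, ZMod.natCast_zmod_val]
    have hxb : (x ν : ZMod (P.sitesPerDir 0)) = (b : ZMod (P.sitesPerDir 0)) := by rw [← hb, ZMod.natCast_zmod_val]
    have hblt : b < P.sitesPerDir 0 := hb ▸ ZMod.val_lt _
    have hq : a / P.L ^ i = (b / P.L ^ i + 1) % P.sitesPerDir i := by
      have := congrArg ZMod.val hzx
      rw [ZMod.val_add, ZMod.val_one_eq_one_mod, Nat.add_mod_mod, val_iterBlockOf i hi, val_iterBlockOf i hi, ha, hb] at this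
      exact this
    have hqblt : b / P.L ^ i + 1 ≤ P.sitesPerDir i := by
      rw [Nat.succ_le_iff, Nat.div_lt_iff_lt_mul hL]; rw [hN] at hblt; exact hblt
    -- opaque quotients and remainders (omega bookkeeping)
    obtain ⟨Li, hLi⟩ : ∃ Li : ℕ, P.L ^ i = Li := ⟨_, rfl⟩
    obtain ⟨qa, hqa⟩ : ∃ q : ℕ, a / P.L ^ i = q := ⟨_, rfl⟩
    obtain ⟨qb, hqb⟩ : ∃ q : ℕ, b / P.L ^ i = q := ⟨_, rfl⟩
    obtain ⟨ra, hra⟩ : ∃ r : ℕ, a % P.L ^ i = r := ⟨_, rfl⟩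
    obtain ⟨rb, hrb⟩ : ∃ r : ℕ, b % P.L ^ i = r := ⟨_, rfl⟩
    have hda : Li * qa + ra = a := by rw [← hLi, ← hqa, ← hra]; exact Nat.div_add_mod a (P.L ^ i)
    have hdb : Li * qb + rb = b := by rw [← hLi, ← hqb, ← hrb]; exact Nat.div_add_mod b (P.L ^ i)
    have hma : ra < Li := by rw [← hra, ← hLi]; exact Nat.mod_lt a hL
    have hmb : rb < Li := by rw [← hrb, ← hLi]; exact Nat.mod_lt b hL
    rw [hqa, hqb] at hq
    rw [hqb] at hqblt
    rcases hqblt.lt_or_eq with hlt | heq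
    · -- no wrap: the index of `z` is the index of `x` plus one
      rw [Nat.mod_eq_of_lt hlt] at hq
      refine ⟨(a : ℤ) - b, ?_, by push_cast; rw [hza, hxb]⟩
      have h1 : Li * qa = Li * qb + Li := by rw [hq, mul_add, mul_one]
      rw [hLi]
      exact abs_le.2 ⟨by omega, by omega⟩
    · -- wrap: the index of `x` is the last one, the index of `z` is `0`
      have hq0 : qa = 0 := by rw [hq, heq, Nat.mod_self]
      refine ⟨(a : ℤ) - b + P.sitesPerDir 0, ?_, by push_cast; rw [hza, hxb, ZMod.natCast_self, add_zero]⟩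
      have h1 : Li * qb + Li = P.sitesPerDir 0 := by rw [hN, ← heq, hLi]; ring
      rw [hq0, mul_zero, zero_add] at hda
      rw [hLi]
      exact abs_le.2 ⟨by omega, by omega⟩
  rcases h with h | h | h
  · -- same index
    obtain ⟨a, ha⟩ : ∃ a : ℕ, (z ν).val = a := ⟨_, rfl⟩
    obtain ⟨b, hb⟩ : ∃ b : ℕ, (x ν).val = b := ⟨_, rfl⟩
    have hza : (z ν : ZMod (P.sitesPerDir 0)) = (a : ZMod (P.sitesPerDir 0)) := by rw [← ha, ZMod.natCast_zmod_val]
    have hxb : (x ν : ZMod (P.sitesPerDir 0)) = (b : ZMod (P.sitesPerDir 0)) := by rw [← hb, ZMod.natCast_zmod_val]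
    have hq : a / P.L ^ i = b / P.L ^ i := by
      have := congrArg ZMod.val h
      rwa [val_iterBlockOf i hi, val_iterBlockOf i hi, ha, hb] at this
    obtain ⟨Li, hLi⟩ : ∃ Li : ℕ, P.L ^ i = Li := ⟨_, rfl⟩
    obtain ⟨q, hqb⟩ : ∃ q : ℕ, b / P.L ^ i = q := ⟨_, rfl⟩
    obtain ⟨ra, hra⟩ : ∃ r : ℕ, a % P.L ^ i = r := ⟨_, rfl⟩
    obtain ⟨rb, hrb⟩ : ∃ r : ℕ, b % P.L ^ i = r := ⟨_, rfl⟩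
    have hda : Li * q + ra = a := by rw [← hLi, ← hqb, ← hq, ← hra]; exact Nat.div_add_mod a (P.L ^ i)
    have hdb : Li * q + rb = b := by rw [← hLi, ← hqb, ← hrb]; exact Nat.div_add_mod b (P.L ^ i)
    have hma : ra < Li := by rw [← hra, ← hLi]; exact Nat.mod_lt a hL
    have hmb : rb < Li := by rw [← hrb, ← hLi]; exact Nat.mod_lt b hL
    refine ⟨(a : ℤ) - b, ?_, by push_cast; rw [hza, hxb]⟩
    rw [hLi]
    exact abs_le.2 ⟨by omega, by omega⟩
  · exact main x z h
  · obtain ⟨e, he, hcast⟩ := main z x h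
    exact ⟨-e, by rw [abs_neg]; exact he, by rw [Int.cast_neg, hcast, neg_sub]⟩

/-- ★★ **THE PRINTED COLLAR `dist(Ω_N, Ω_{N−1}ᶜ) ≥ L^N M₁` AT THE FINE LEVEL** ([III] (2.13), `B14.Eq213DetSet.dist_maxDomT` read back on the torus): for `M₁ ≥ 2`, `1 ≤ N ≤ k` (cover
divisibility at `k`) and `i ≤ N`, if `x ∈ Ω_N` and the `i`-block indices of `z` and `x` agree or differ by one in every coordinate (the `i`-block of `z` is the `i`-block of `x` or a
neighbour of it, straight or diagonal), then `z ∈ Ω_{N−1}` (the two labels differ by at most `2L^i − 1 ≤ L^N M₁ − 1` in every coordinate). [cite: Balaban1988Convergent, (2.13) pp.256–257] -/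
theorem mem_maxDomT_pred_of_blockIdx {M₁ k : ℕ} {Z : Set (Site P 0)} (hM2 : 2 ≤ M₁) (hdiv : side P.L M₁ k ∣ P.sitesPerDir 0) (hk : k ≤ P.m + P.K)
    {N : ℕ} (hN1 : 1 ≤ N) (hNk : N ≤ k) {i : ℕ} (hi : i ≤ N) {x z : Site P 0} (hx : x ∈ maxDomT M₁ Z N)
    (hadj : ∀ ν, iterBlockOf i z ν = iterBlockOf i x ν ∨ iterBlockOf i z ν = iterBlockOf i x ν + 1 ∨ iterBlockOf i x ν = iterBlockOf i z ν + 1) :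
    z ∈ maxDomT M₁ Z (N - 1) := by
  obtain ⟨n, rfl⟩ : ∃ n, N = n + 1 := ⟨N - 1, by omega⟩
  rw [Nat.add_sub_cancel]
  choose e he hcast using fun ν => exists_int_rep_of_blockIdx (hi.trans (hNk.trans hk)) x z ν (hadj ν)
  have hx' : cover P (lift P x) ∈ maxDomT M₁ Z (n + 1) := by rw [cover_lift]; exact hx
  have hy : cover P (lift P x + e) = z := by
    funext ν
    rw [cover_apply, Pi.add_apply, Int.cast_add, hcast]
    show (((lift P x ν : ℤ)) : ZMod (P.sitesPerDir 0)) + (z ν - x ν) = z ν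
    rw [lift, Int.cast_natCast, ZMod.natCast_zmod_val, add_sub_cancel]
  have hwithin : Within ((side P.L M₁ (n + 1) : ℤ) - 1) (lift P x) (lift P x + e) := by
    intro ν
    rw [Pi.add_apply, sub_add_cancel_left, abs_neg]
    refine (he ν).trans ?_
    have h1 : P.L ^ i ≤ P.L ^ (n + 1) := Nat.pow_le_pow_right P.L_pos hi
    have h2 : 2 * P.L ^ (n + 1) ≤ side P.L M₁ (n + 1) := by unfold side; rw [mul_comm]; exact Nat.mul_le_mul_left _ hM2
    have h3 : 2 * P.L ^ i ≤ side P.L M₁ (n + 1) := (Nat.mul_le_mul_left 2 h1).trans h2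
    omega
  rw [← hy]
  exact dist_maxDomT (by omega) hdiv (show n + 1 ≤ k from hNk) hx' hwithin

end Collar

/-! ## §2 The record's `𝐁_k(Z)`: the `Γ`-level of a site, and where the root points of a `Γ_J`-block can be -/

section BjGeometry

variable {M₁ k : ℕ} {Z : Set (Site P 0)}

/-- Sites of one `i`-block, `i ≤ n`, lie in `Ω_n` together (`Ω_n` is a union of `n`-blocks, `1 ≤ n ≤ k`). [cite: Balaban1988Convergent, (2.13) pp.256–257] -/
theorem mem_maxDomT_iff_of_iterBlockOf_eq (hM : 1 ≤ M₁) (hdiv : side P.L M₁ k ∣ P.sitesPerDir 0) (hk : k ≤ P.m + P.K) {n : ℕ} (hn1 : 1 ≤ n) (hnk : n ≤ k)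
    {i : ℕ} (hin : i ≤ n) {w w' : Site P 0} (h : iterBlockOf i w = iterBlockOf i w') : w ∈ maxDomT M₁ Z n ↔ w' ∈ maxDomT M₁ Z n := by
  have hU := isBlockUnion_maxDomT hM (Ω := Z) hdiv hn1 hnk (hnk.trans hk)
  rw [hU w, hU w', blockIter_eq_iterBlockOf, blockIter_eq_iterBlockOf, iterBlockOf_congr_of_le hin h]

/-- A member level is at most `k`. [cite: Balaban1988Convergent, (2.2) p.255, (2.13) pp.256–257] -/
theorem le_of_iterBlockOf_mem_Bj {J : ℕ} {z : Site P 0} (hz : iterBlockOf J z ∈ (Bj M₁ Z k : DetSet P) J) : J ≤ k := by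
  by_contra h
  rw [Bj_of_gt (not_le.mp h)] at hz
  exact hz

/-- A site whose `J`-block is a member (`J ≥ 1`) lies in `Ω_J`. [cite: Balaban1988Convergent, (2.2) p.255, (2.13) pp.256–257] -/
theorem mem_maxDomT_of_iterBlockOf_mem_Bj (hM : 1 ≤ M₁) (hdiv : side P.L M₁ k ∣ P.sitesPerDir 0) (hk : k ≤ P.m + P.K) {J : ℕ} (hJ1 : 1 ≤ J)
    {z : Site P 0} (hz : iterBlockOf J z ∈ (Bj M₁ Z k : DetSet P) J) : z ∈ maxDomT M₁ Z J := by
  have hJk := le_of_iterBlockOf_mem_Bj hz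
  have hctr : embIter J (iterBlockOf J z) ∈ maxDomT M₁ Z J := by
    rcases hJk.lt_or_eq with hlt | heq
    · rw [Bj_mid hJ1 hlt] at hz; exact mem_pts.1 hz.1
    · rw [heq] at hz ⊢; rw [Bj_top] at hz; exact mem_pts.1 hz
  have hU := isBlockUnion_maxDomT hM (Ω := Z) hdiv hJ1 hJk (hJk.trans hk)
  rw [hU z, blockIter_eq_iterBlockOf]
  exact hctr

/-- A site whose `J`-block is a member lies in NO `Ω_n`, `J < n ≤ k`. [cite: Balaban1988Convergent, (2.2) p.255, (2.13) pp.256–257] -/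
theorem not_mem_maxDomT_of_iterBlockOf_mem_Bj (hM : 1 ≤ M₁) (hdiv : side P.L M₁ k ∣ P.sitesPerDir 0) (hk : k ≤ P.m + P.K) {J n : ℕ} (hJn : J < n) (hnk : n ≤ k)
    {z : Site P 0} (hz : iterBlockOf J z ∈ (Bj M₁ Z k : DetSet P) J) : z ∉ maxDomT M₁ Z n := by
  intro hzn
  have hz1 : z ∈ maxDomT M₁ Z (J + 1) := maxDomT_antitone hM Z (Nat.succ_le_of_lt hJn) hzn
  rcases Nat.eq_zero_or_pos J with hJ0 | hJ0
  · subst hJ0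
    rw [Bj_zero (by omega)] at hz
    exact hz (by simpa using hz1)
  · rw [Bj_mid hJ0 (by omega)] at hz
    refine hz.2 (mem_pts.2 ?_)
    have hU := isBlockUnion_maxDomT_succ hM (Ω := Z) hdiv (show J + 1 ≤ k by omega) (by omega : J ≤ P.m + P.K)
    rw [← blockIter_eq_iterBlockOf]
    exact (hU z).1 hz1

/-- **THE `Γ`-LEVEL OF A SITE IS UNIQUE**: the fine regions of `Γ_0, …, Γ_k` are pairwise disjoint. [cite: Balaban1988Convergent, (2.2) p.255, (2.13) pp.256–257] -/
theorem eq_of_iterBlockOf_mem_Bj (hM : 1 ≤ M₁) (hdiv : side P.L M₁ k ∣ P.sitesPerDir 0) (hk : k ≤ P.m + P.K) {J J' : ℕ} {z : Site P 0}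
    (hz : iterBlockOf J z ∈ (Bj M₁ Z k : DetSet P) J) (hz' : iterBlockOf J' z ∈ (Bj M₁ Z k : DetSet P) J') : J = J' := by
  by_contra hne
  rcases lt_or_gt_of_ne hne with hlt | hgt
  · exact not_mem_maxDomT_of_iterBlockOf_mem_Bj hM hdiv hk hlt (le_of_iterBlockOf_mem_Bj hz') hz
      (mem_maxDomT_of_iterBlockOf_mem_Bj hM hdiv hk (by omega) hz')
  · exact not_mem_maxDomT_of_iterBlockOf_mem_Bj hM hdiv hk hgt (le_of_iterBlockOf_mem_Bj hz) hz'
      (mem_maxDomT_of_iterBlockOf_mem_Bj hM hdiv hk (by omega) hz)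

/-- The two ends of a lattice bond have block indices agreeing or differing by one in every coordinate. [folklore] -/
theorem idx_adj_of_bond {j : ℕ} (c : PBond P j) {y y₀ : Site P j} (hy : y = c.src ∨ y = c.tgt) (hy₀ : y₀ = c.src ∨ y₀ = c.tgt) :
    ∀ κ, y₀ κ = y κ ∨ y₀ κ = y κ + 1 ∨ y κ = y₀ κ + 1 := by
  intro κ
  have htgt : ∀ κ, c.tgt κ = if κ = c.dir then c.src κ + 1 else c.src κ := fun κ => by
    show Function.update c.src c.dir (c.src c.dir + 1) κ = _
    by_cases h : κ = c.dir
    · subst h; rw [Function.update_self, if_pos rfl]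
    · rw [Function.update_of_ne h, if_neg h]
  rcases hy with rfl | rfl <;> rcases hy₀ with rfl | rfl
  · exact Or.inl rfl
  · rw [htgt κ]; by_cases h : κ = c.dir
    · rw [if_pos h]; exact Or.inr (Or.inl rfl)
    · rw [if_neg h]; exact Or.inl rfl
  · rw [htgt κ]; by_cases h : κ = c.dir
    · rw [if_pos h]; exact Or.inr (Or.inr rfl)
    · rw [if_neg h]; exact Or.inl rfl
  · exact Or.inl rfl

/-- ★★ **WHERE THE ROOT POINTS OF A `Γ_J`-BLOCK ARE** (the printed collar at work): if the `J`-block of `z` is a member of `𝐁_k(Z)` (`M₁ ≥ 2`) and a point `p` of the root set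
`R(𝐁_k(Z), k)` lies in that `J`-block, then EITHER `p` is the block's centre, OR `J ≥ 1` and `p` is the centre of its own `(J−1)`-block, which is an end of a member `(J−1)`-bond —
root points of levels `≤ J − 2` inside the block, and members of level `J − 1` inside it, are excluded by `dist(Ω_J, Ω_{J−1}ᶜ) ≥ L^J M₁` and the disjointness of the `Γ_n`.
[cite: Balaban1988Convergent, (2.2) p.255, (2.13) pp.256–257; Balaban1985Variational, (3)–(4) p.278] -/
theorem rootPoint_classification (hM2 : 2 ≤ M₁) (hdiv : side P.L M₁ k ∣ P.sitesPerDir 0) (hk : k ≤ P.m + P.K) {J : ℕ} {z p : Site P 0}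
    (hz : iterBlockOf J z ∈ (Bj M₁ Z k : DetSet P) J)
    (hp : p ∈ {z : Site P 0 | ∃ j, j ≤ k ∧ ∃ c ∈ bondsOf ((Bj M₁ Z k : DetSet P) j), (z = embIter j c.src ∨ z = embIter j c.tgt)})
    (hpz : iterBlockOf J p = iterBlockOf J z) :
    p = embIter J (iterBlockOf J z) ∨
      (1 ≤ J ∧ p = embIter (J - 1) (iterBlockOf (J - 1) p) ∧
        ∃ c ∈ bondsOf ((Bj M₁ Z k : DetSet P) (J - 1)), iterBlockOf (J - 1) p = c.src ∨ iterBlockOf (J - 1) p = c.tgt) := by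
  have hM : 1 ≤ M₁ := by omega
  have hJk := le_of_iterBlockOf_mem_Bj hz
  obtain ⟨j, hj, c, hc, hpc⟩ := hp
  -- `p = ι_j y`, `y` an end of the member bond `c`
  obtain ⟨y, hy, rfl⟩ : ∃ y : Site P j, (y = c.src ∨ y = c.tgt) ∧ p = embIter j y := by
    rcases hpc with h | h
    · exact ⟨c.src, Or.inl rfl, h⟩
    · exact ⟨c.tgt, Or.inr rfl, h⟩
  by_cases hJj : J ≤ j
  · -- a centre of level `≥ J` inside the block is the block's centre
    left
    rw [← hpz, embIter_iterBlockOf_embIter (hJk.trans hk) hJj]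
  · right
    have hjJ : j < J := not_le.mp hJj
    have hJ1 : 1 ≤ J := by omega
    have hy' : iterBlockOf j (embIter j y) = y := iterBlockOf_embIter j (hj.trans hk) y
    -- the level of the member bond is `J − 1`: smaller levels are excluded by the collar
    suffices hjJ' : j = J - 1 by
      subst hjJ'
      exact ⟨hJ1, by rw [hy'], c, hc, by rw [hy']; exact hy⟩
    by_contra hne
    have hj2 : j + 2 ≤ J := by omega
    -- the member end `y₀ ∈ 𝐁_j` of `c`, its centre `x₀`
    obtain ⟨y₀, hy₀mem, hy₀⟩ : ∃ y₀ : Site P j, y₀ ∈ (Bj M₁ Z k : DetSet P) j ∧ (y₀ = c.src ∨ y₀ = c.tgt) := by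
      rcases hc with h | h
      · exact ⟨c.src, h, Or.inl rfl⟩
      · exact ⟨c.tgt, h, Or.inr rfl⟩
    have hx₀ : iterBlockOf j (embIter j y₀) = y₀ := iterBlockOf_embIter j (hj.trans hk) y₀
    have hx₀mem : iterBlockOf j (embIter j y₀) ∈ (Bj M₁ Z k : DetSet P) j := by rw [hx₀]; exact hy₀mem
    -- `p ∈ Ω_J` (same `J`-block as `z`), hence `x₀ ∈ Ω_{J−1}` by the collar — but `x₀ ∈ Γ_j`, `j < J − 1`
    have hpΩ : embIter j y ∈ maxDomT M₁ Z J :=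
      (mem_maxDomT_iff_of_iterBlockOf_eq hM hdiv hk hJ1 hJk le_rfl hpz).2 (mem_maxDomT_of_iterBlockOf_mem_Bj hM hdiv hk hJ1 hz)
    have hx₀Ω : embIter j y₀ ∈ maxDomT M₁ Z (J - 1) :=
      mem_maxDomT_pred_of_blockIdx hM2 hdiv hk hJ1 hJk hjJ.le hpΩ fun κ => by
        rw [hx₀, hy']; exact idx_adj_of_bond c hy hy₀ κ
    exact not_mem_maxDomT_of_iterBlockOf_mem_Bj hM hdiv hk (show j < J - 1 by omega) (by omega) hx₀mem hx₀Ω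

/-- ★ Corollary: **every root point inside a `Γ_J`-block, `J ≥ 1`, is the centre of its own `(J−1)`-block** (the block's centre is the centre of its central `(J−1)`-block).
[cite: Balaban1988Convergent, (2.13) pp.256–257; Balaban1985Variational, (3)–(4) p.278] -/
theorem rootPoint_eq_centre_pred (hM2 : 2 ≤ M₁) (hdiv : side P.L M₁ k ∣ P.sitesPerDir 0) (hk : k ≤ P.m + P.K) {J : ℕ} (hJ1 : 1 ≤ J) {z p : Site P 0}
    (hz : iterBlockOf J z ∈ (Bj M₁ Z k : DetSet P) J)
    (hp : p ∈ {z : Site P 0 | ∃ j, j ≤ k ∧ ∃ c ∈ bondsOf ((Bj M₁ Z k : DetSet P) j), (z = embIter j c.src ∨ z = embIter j c.tgt)})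
    (hpz : iterBlockOf J p = iterBlockOf J z) : p = embIter (J - 1) (iterBlockOf (J - 1) p) := by
  have hJk := le_of_iterBlockOf_mem_Bj hz
  rcases rootPoint_classification hM2 hdiv hk hz hp hpz with h | ⟨-, h, -⟩
  · conv_rhs => rw [h]
    rw [embIter_iterBlockOf_embIter (by omega : J - 1 ≤ P.m + P.K) (by omega : J - 1 ≤ J)]
    exact h
  · exact h

/-- ★★ **A SITE OF A FACE-LAYER `(J−1)`-BLOCK HANGS FROM THAT BLOCK's CENTRE**: for any rooted forest of `R(𝐁_k(Z), k)` with the (ROOTBLK) property at the levels `J − 1` and `J`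
(`N12TowerForestWords.exists_towerForest_words_Bj`), if the `J`-block of `z` is a member and the centre of its `(J−1)`-block is a root point, then `root z` IS that centre.
[cite: Balaban1988Convergent, (2.13) pp.256–257; Balaban1985Variational, (3)–(4) p.278, (16)–(18) p.280] -/
theorem root_eq_centre_pred_of_rooted (hM2 : 2 ≤ M₁) (hdiv : side P.L M₁ k ∣ P.sitesPerDir 0) (hk : k ≤ P.m + P.K) {J : ℕ} (hJ1 : 1 ≤ J) {z r : Site P 0}
    (hz : iterBlockOf J z ∈ (Bj M₁ Z k : DetSet P) J)
    (hr : r ∈ {z : Site P 0 | ∃ j, j ≤ k ∧ ∃ c ∈ bondsOf ((Bj M₁ Z k : DetSet P) j), (z = embIter j c.src ∨ z = embIter j c.tgt)})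
    (hblkJ : iterBlockOf J r = iterBlockOf J z) (hblk : iterBlockOf (J - 1) r = iterBlockOf (J - 1) z) :
    r = embIter (J - 1) (iterBlockOf (J - 1) z) := by
  rw [← hblk]
  exact rootPoint_eq_centre_pred hM2 hdiv hk hJ1 hz hr hblkJ

end BjGeometry

end Summit.QuantumFields.YangMills.BalabanUVNodes.N12BjCollarRoots

end
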